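import Literature.Computability.Complexity.TVLengthLemmas
import Literature.Computability.Complexity.DownwardChainChecker
import HarnessLib

/-!
# The downward checker of Trevisan–Vadhan's language at its own (small) field: stage degrees of the
# fine schedule, and the `1/3`-soundness of sixty-four function-restricted LFKN runs

Literature / complexity — the instantiation of `DownwardChainChecker.lean` (Lund–Fortnow–Karloff–Nisan
verification down a polynomial chain against a FIXED oracle: `ChainCheck.Chain.checksV`,
`checksV_of_honest`, `prob_forall_checksV_le`) at Trevisan–Vadhan's universal family
`f_{n,i} = QBFUniv.fam (K n) n i` (`QBFUniversal.lean`, `TVFunction.lean`): the machine-free half of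
the DOWNWARD CHECKER that Murray–Williams' Thm. 2.2 (SIAM Thm. 2.7; Santhanam 2009, Lemma 12) asks of
the `PSPACE`-complete language (`AlmostAE.SameLengthChecker.ofOnesZeroPad`, `OnesZeroPadding.lean`).

The point is the field size. `TVFunction.lean` fixes `K n = GF(2^{Mof n + 1})` with
`Dn n + 2 ≤ |K n| ≤ 2 (Dn n + 1)`, `Dn n = N n · max 3 (2n)` — enough for Trevisan–Vadhan's purposes
(self-correction), but so small that the textbook union bound `m δ / |K|` over the `m = mlen n =
n (N n + 1)` stages with the uniform per-variable degree `δ = max 3 (2n)` (`degreeOf_fam_le`) exceeds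
`1`. The schedule is finer than that bound: reading the fine schedule `uops n` (blocks
`[quant b, lin 0, …, lin (N n - 1)]`, outermost block first, the matrix innermost), the axis
restriction the verifier reads at stage `i` — `f_{n,i+1}` along `opVar (uops n)[i]` — has degree

* `≤ 1` at a quantifier stage (the variable `x_b` has just been linearized: `degreeOf_foldr_lin_le`),
* `≤ max 1 (2n)` at a linearization stage of the innermost block (the matrix has degree `≤ 2n` in every
  variable, `degreeOf_matrixPoly_le`),
* `≤ 3` at a linearization stage of any other block (the output of a selected quantifier step on a
  fully linearized polynomial, `degreeOf_opQ_le`),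

(`QBFUniv.stageDeg`, **`QBFUniv.degreeOf_opVar_fam_succ_le`**), so that
`2 Σ_{i < mlen n} stageDeg n i ≤ 5 (Dn n + 2) ≤ 5 |K n|` (**`QBFUniv.two_mul_sum_stageDeg_le`**) and
`2 · stageDeg n i ≤ Dn n + 2`. By the product form of the soundness error and `4^{-x} ≤ 1 - x`
(`DownwardChainChecker.lean`) one run of the checker accepts a false claim with probability `≤ 31/32`,
and `64` independent runs are `1/3`-sound:

* `QBFUniv.tvChain n hn : ChainCheck.Chain (K n) (Fin (N n))` (levels `x ↦ f_{n,i}(x)`, axes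
  `opVar`, rules `opValue`; `n > 0`), `tvChain_rule` (`Fni_eq_of_queries` / `fam_succ`),
  `tvChain_axisDegreeV`; the nodes `QBFUniv.node n l` (the field element with bit pattern `l`,
  `decF`) with `nodesInj_node`;
* **`QBFUniv.tv_checksV_of_honest`** — against a level oracle truthful on the deeper levels
  `i+1, …, mlen n`, every run returns exactly `good (f_{n,i}(x))` (perfect completeness, and no false
  positives from an honest oracle);
* **`QBFUniv.tv_prob_forall_checksV_le`** — if `good (f_{n,i}(x)) = false`, then against EVERY level
  oracle at most a `1/3` fraction of the `64 (mlen n - i)`-tuples of challenges make all `64` runs accept;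
* `QBFUniv.pointOracle` (the level oracle read off a word oracle through `wordOf`, `blk n` Boolean
  queries per field value) with `pointOracle_eq_eval`: a word oracle right on the words of length
  `h n i'` is truthful on level `i'` — the deeper levels are the SHORTER canonical lengths
  (`h n (i+1) < h n i`), which is the downward discipline;
* generic, for the machine (`ChainCheck.Chain.pointSeq`, `claimSeq`, **`acceptsV_eq_true_iff`**,
  **`checksV_succ_eq_true_iff`**): a run UNROLLED along a challenge sequence — stage `s` reads the
  start point with the first `s` axes set to the first `s` challenges and tests the rule's value on
  the oracle's interpolant against the previous interpolant at the previous challenge; the last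
  claim is tested against the level reached — the form a machine recomputes stage by stage.

Not here: the probabilistic oracle MACHINE realizing `checksV` on words (parsing `n, i` off the length,
`stageDeg n i + 1` node queries of `blk n` bits each at length `h n (i'+1)`, Lagrange evaluation and
the operator bricks `TVFieldBricks.opQuantF/opLinF`, the matrix brick `TVMatrixBricks.matrixF` at the
bottom, `blk n` coins per challenge) and its running time. Everything is proved; no named fact is
introduced (D-0026). Mathlib has the algebra used (via the imported files); nothing in the tree
analyses Trevisan–Vadhan's schedule stage by stage (searched `stageDeg`, `uops_getElem`,
`degreeOf_fam`, `checksV`, 2026-08-15).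

## References

* L. Trevisan, S. Vadhan, *Pseudorandomness and average-case complexity via uniform reductions*,
  Comput. Complexity 16 (2007) 331–364, Lemma 4.1 (i), (iii) and its proof (the sequence
  `f_{n,0}, …, f_{n,m(n)}`), Thm. 4.3, Thm. 5.4 [TrevisanVadhan2007].
* C. Lund, L. Fortnow, H. Karloff, N. Nisan, *Algebraic methods for interactive proof systems*,
  J. ACM 39 (1992) 859–868, §3 [LundEtAl1992].
* S. Arora, B. Barak, *Computational Complexity: A Modern Approach*, CUP 2009, §8.3.3 (degree
  bookkeeping with linearization; the Claim in the proof of Thm. 8.21) [AroraBarakCC2009].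
* R. Santhanam, *Circuit lower bounds for Merlin–Arthur classes*, SIAM J. Comput. 39 (2009)
  1038–1061, Lemma 12 [Santhanam2009].
* C. D. Murray, R. R. Williams, *Circuit lower bounds for nondeterministic quasi-polytime …*,
  SIAM J. Comput. 49(5) (2020), Thm. 2.7 [MurrayWilliams2018].
-/

noncomputable section

namespace Literature.Computability.Complexity

/-! ### Unrolling a run: the points and claims along a challenge sequence

The verifier's recursion (`ChainCheck.Chain.acceptsV`) threads a point and a claim; a machine
recomputes both from the input and the challenges. Stage `s` of a run started at level `i` reads the
point `pointSeq s` (the start point with the axes `a i, …, a (i+s-1)` set to the first `s`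
challenges) and compares the rule's value on the oracle's interpolant with the claim `claimSeq s`
(the previous interpolant at the previous challenge); the last claim is compared with the level
`P (i+j)` itself. -/

namespace ChainCheck.Chain

open Finset Polynomial

variable {K : Type*} [Field K] [DecidableEq K] {V : Type*} [DecidableEq V]
variable (C : ChainCheck.Chain K V) (ν : ℕ → K) (δs : ℕ → ℕ)

/-- **The point at stage `s`** of a run from level `i` at `x` along the challenges `ρ 0, ρ 1, …`.
[cite: LundEtAl1992, §3] -/
def pointSeq (i : ℕ) (x : V → K) (ρ : ℕ → K) : ℕ → (V → K)
  | 0 => x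
  | s + 1 => Function.update (pointSeq i x ρ s) (C.a (i + s)) (ρ s)

omit [Field K] [DecidableEq K] in
/-- The start point. [folklore] -/
@[simp] theorem pointSeq_zero (i : ℕ) (x : V → K) (ρ : ℕ → K) : C.pointSeq i x ρ 0 = x := rfl

omit [Field K] [DecidableEq K] in
/-- One more challenge. [folklore] -/
theorem pointSeq_succ (i : ℕ) (x : V → K) (ρ : ℕ → K) (s : ℕ) :
    C.pointSeq i x ρ (s + 1) = Function.update (C.pointSeq i x ρ s) (C.a (i + s)) (ρ s) := rfl

/-- **The claim at stage `s`**: the initial claim, then the previous interpolant at the previous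
challenge. [cite: LundEtAl1992, §3] -/
def claimSeq (O : ℕ → (V → K) → K) (i : ℕ) (x : V → K) (ρ : ℕ → K) (v : K) : ℕ → K
  | 0 => v
  | s + 1 => (C.claimPoly ν δs O (i + s) (C.pointSeq i x ρ s)).eval (ρ s)

omit [DecidableEq K] in
/-- The initial claim. [folklore] -/
@[simp] theorem claimSeq_zero (O : ℕ → (V → K) → K) (i : ℕ) (x : V → K) (ρ : ℕ → K) (v : K) :
    C.claimSeq ν δs O i x ρ v 0 = v := rfl

omit [DecidableEq K] in
/-- The later claims. [folklore] -/
theorem claimSeq_succ (O : ℕ → (V → K) → K) (i : ℕ) (x : V → K) (ρ : ℕ → K) (v : K) (s : ℕ) :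
    C.claimSeq ν δs O i x ρ v (s + 1) = (C.claimPoly ν δs O (i + s) (C.pointSeq i x ρ s)).eval (ρ s) := rfl

omit [Field K] [DecidableEq K] in
/-- Shifting the start by one stage: points. [folklore] -/
theorem pointSeq_succ_shift (i : ℕ) (x : V → K) (ρ : ℕ → K) (s : ℕ) :
    C.pointSeq (i + 1) (Function.update x (C.a i) (ρ 0)) (fun s => ρ (s + 1)) s = C.pointSeq i x ρ (s + 1) := by
  induction s with
  | zero => rw [pointSeq_zero, pointSeq_succ, pointSeq_zero, Nat.add_zero]
  | succ s ih => rw [pointSeq_succ, pointSeq_succ, ih, Nat.add_right_comm, Nat.add_assoc]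

omit [DecidableEq K] in
/-- Shifting the start by one stage: claims. [folklore] -/
theorem claimSeq_succ_shift (O : ℕ → (V → K) → K) (i : ℕ) (x : V → K) (ρ : ℕ → K) (v : K) (s : ℕ) :
    C.claimSeq ν δs O (i + 1) (Function.update x (C.a i) (ρ 0)) (fun s => ρ (s + 1))
        ((C.claimPoly ν δs O i x).eval (ρ 0)) s = C.claimSeq ν δs O i x ρ v (s + 1) := by
  cases s with
  | zero => rw [claimSeq_zero, claimSeq_succ, pointSeq_zero, Nat.add_zero]
  | succ s => rw [claimSeq_succ, claimSeq_succ, pointSeq_succ_shift, Nat.add_right_comm, Nat.add_assoc]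

/-- **The run, unrolled**: `acceptsV` from the claim `v` along the challenges `ρ` accepts iff every
stage's consistency test `c (i+s) xₛ (qₛ 0) (qₛ 1) = vₛ` passes and the last claim is the value of the
level reached. [cite: LundEtAl1992, §3] [cite: AroraBarakCC2009, §8.3.2 (the sumcheck protocol, unrolled)] -/
theorem acceptsV_eq_true_iff (O : ℕ → (V → K) → K) :
    ∀ (j i : ℕ) (x : V → K) (v : K) (ρ : ℕ → K),
      C.acceptsV ν δs O j i x v (fun s => ρ s) = true ↔
        (∀ s < j, C.c (i + s) (C.pointSeq i x ρ s) ((C.claimPoly ν δs O (i + s) (C.pointSeq i x ρ s)).eval 0)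
            ((C.claimPoly ν δs O (i + s) (C.pointSeq i x ρ s)).eval 1) = C.claimSeq ν δs O i x ρ v s) ∧
          C.P (i + j) (C.pointSeq i x ρ j) = C.claimSeq ν δs O i x ρ v j
  | 0, i, x, v, ρ => by
    simp [acceptsV, pointSeq_zero, claimSeq_zero]
  | j + 1, i, x, v, ρ => by
    have hfun : (fun s : Fin (j + 1) => ρ s) = Fin.cons (ρ 0) (fun s : Fin j => ρ (s.val + 1)) := by
      funext s
      refine Fin.cases rfl (fun s => ?_) s
      simp
    rw [hfun, acceptsV_succ_cons, Bool.and_eq_true, decide_eq_true_eq,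
      acceptsV_eq_true_iff O j (i + 1) _ _ (fun s => ρ (s + 1))]
    simp only [pointSeq_succ_shift, claimSeq_succ_shift _ _ _ O i x ρ v]
    constructor
    · rintro ⟨h0, hall, hlast⟩
      refine ⟨fun s hs => ?_, ?_⟩
      · rcases s with _ | s
        · simpa [pointSeq_zero, claimSeq_zero] using h0
        · have := hall s (by omega)
          rwa [Nat.add_right_comm, Nat.add_assoc] at this
      · rwa [Nat.add_right_comm, Nat.add_assoc] at hlast
    · rintro ⟨hall, hlast⟩
      refine ⟨by simpa [pointSeq_zero, claimSeq_zero] using hall 0 (Nat.succ_pos _), fun s hs => ?_, ?_⟩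
      · have := hall (s + 1) (by omega)
        rwa [Nat.add_right_comm, Nat.add_assoc]
      · rwa [Nat.add_right_comm, Nat.add_assoc]

/-- **The membership run, unrolled** (`j ≥ 1` stages): with the first claim read off the oracle,
`checksV` accepts iff that claim is `good`, the later consistency tests pass, and the last claim is the
value of the level reached (the first test holds by construction). [cite: LundEtAl1992, §3] [cite: Santhanam2009, Lemma 12] -/
theorem checksV_succ_eq_true_iff (O : ℕ → (V → K) → K) (good : K → Bool) (j i : ℕ) (x : V → K) (ρ : ℕ → K) :
    C.checksV ν δs O good (j + 1) i x (fun s => ρ s) = true ↔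
      good (C.c i x ((C.claimPoly ν δs O i x).eval 0) ((C.claimPoly ν δs O i x).eval 1)) = true ∧
        (∀ s, 1 ≤ s → s < j + 1 →
          C.c (i + s) (C.pointSeq i x ρ s) ((C.claimPoly ν δs O (i + s) (C.pointSeq i x ρ s)).eval 0)
            ((C.claimPoly ν δs O (i + s) (C.pointSeq i x ρ s)).eval 1) =
              (C.claimPoly ν δs O (i + (s - 1)) (C.pointSeq i x ρ (s - 1))).eval (ρ (s - 1))) ∧
          C.P (i + (j + 1)) (C.pointSeq i x ρ (j + 1)) = (C.claimPoly ν δs O (i + j) (C.pointSeq i x ρ j)).eval (ρ j) := by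
  rw [checksV, Bool.and_eq_true, acceptsV_eq_true_iff]
  have hclaim : ∀ s, 1 ≤ s → C.claimSeq ν δs O i x ρ
      (C.c i x ((C.claimPoly ν δs O i x).eval 0) ((C.claimPoly ν δs O i x).eval 1)) s =
        (C.claimPoly ν δs O (i + (s - 1)) (C.pointSeq i x ρ (s - 1))).eval (ρ (s - 1)) := by
    intro s hs
    obtain ⟨s, rfl⟩ : ∃ s', s = s' + 1 := ⟨s - 1, by omega⟩
    rfl
  have hlastc := hclaim (j + 1) (by omega)
  rw [Nat.add_sub_cancel] at hlastc
  constructor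
  · rintro ⟨hg, hall, hlast⟩
    refine ⟨hg, fun s hs1 hs2 => ?_, ?_⟩
    · rw [← hclaim s hs1]; exact hall s hs2
    · rw [← hlastc]; exact hlast
  · rintro ⟨hg, hall, hlast⟩
    refine ⟨hg, fun s hs => ?_, ?_⟩
    · rcases Nat.eq_zero_or_pos s with rfl | hs1
      · rfl
      · rw [hclaim s hs1]; exact hall s hs1 hs
    · rw [hlastc]; exact hlast

end ChainCheck.Chain

namespace QBFUniv

open MvPolynomial Finset ChainCheck Literature.InformationTheory.Coding


/-! ### Flattened blocks: dropping into a block -/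

/-- Dropping `b · c + t` elements of a flattened list of blocks of length `c` (`t ≤ c`): the rest of
block `b`, then the later blocks. [folklore] -/
theorem drop_flatten_of_length {α : Type*} (L : List (List α)) (c : ℕ) (hL : ∀ l ∈ L, l.length = c)
    (b t : ℕ) (hb : b < L.length) (ht : t ≤ c) :
    L.flatten.drop (b * c + t) = (L[b]).drop t ++ (L.drop (b + 1)).flatten := by
  induction L generalizing b with
  | nil => simp at hb
  | cons l L ih =>
    have hl : l.length = c := hL l (by simp)
    rcases b with _ | b
    · simp only [List.flatten_cons, zero_mul, zero_add, List.getElem_cons_zero, List.drop_succ_cons, List.drop_zero]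
      rw [List.drop_append_of_le_length (by rw [hl]; exact ht)]
    · simp only [List.flatten_cons, List.getElem_cons_succ, List.drop_succ_cons]
      have hb' : b < L.length := by simpa using hb
      have e : (b + 1) * c + t = l.length + (b * c + t) := by rw [hl]; ring
      rw [e, List.drop_append, List.drop_eq_nil_of_le (Nat.le_add_right _ _), List.nil_append, Nat.add_sub_cancel_left]
      exact ih (fun l' hl' => hL l' (by simp [hl'])) b hb'

/-- The later blocks of a flattened list: drop `(b+1) · c`. [folklore] -/
theorem drop_flatten_succ_mul {α : Type*} (L : List (List α)) (c : ℕ) (hL : ∀ l ∈ L, l.length = c)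
    (b : ℕ) (hb : b < L.length) :
    L.flatten.drop ((b + 1) * c) = (L.drop (b + 1)).flatten := by
  have h := drop_flatten_of_length L c hL b c hb le_rfl
  have hlen : (L[b]).length = c := hL _ (List.getElem_mem hb)
  rw [List.drop_eq_nil_of_le (as := L[b]) (by rw [hlen]), List.nil_append] at h
  rw [show (b + 1) * c = b * c + c by ring]
  exact h

section Schedule

variable {R : Type*} [CommRing R] {n : ℕ}

/-- **Inside block `b` of the fine schedule**: for `t ≤ N n + 1`,
`f_{n, b(N+1)+t}` is the remaining operators of block `b` applied to `f_{n, (b+1)(N+1)}`.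
[cite: TrevisanVadhan2007, Lemma 4.1 (proof)] -/
theorem fam_block (b : Fin n) {t : ℕ} (ht : t ≤ N n + 1) :
    fam R n (b.val * (N n + 1) + t) = ((ublockOps n b).drop t).foldr applyU (fam R n ((b.val + 1) * (N n + 1))) := by
  have hL : ∀ l ∈ (List.finRange n).map (ublockOps n), l.length = N n + 1 := by
    intro l hl
    obtain ⟨b', -, rfl⟩ := List.mem_map.1 hl
    exact length_ublockOps n b'
  have hb : b.val < ((List.finRange n).map (ublockOps n)).length := by simp
  have h1 := drop_flatten_of_length ((List.finRange n).map (ublockOps n)) (N n + 1) hL b.val t hb ht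
  have h2 := drop_flatten_succ_mul ((List.finRange n).map (ublockOps n)) (N n + 1) hL b.val hb
  have hget : ((List.finRange n).map (ublockOps n))[b.val] = ublockOps n b := by simp
  rw [fam, fam, uops, h1, h2, List.foldr_append, hget]

/-- After the linearization sweep of block `b`: `f_{n, b(N+1)+1}` is every variable linearized over
`f_{n,(b+1)(N+1)}`. [cite: TrevisanVadhan2007, Lemma 4.1 (proof)] -/
theorem fam_blockStart_succ (b : Fin n) :
    fam R n (b.val * (N n + 1) + 1) = ((List.finRange (N n)).map UOp.lin).foldr applyU (fam R n ((b.val + 1) * (N n + 1))) := by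
  rw [fam_block b (by omega : 1 ≤ N n + 1)]; rfl

/-- The degree bound at the end of block `b` (the input of its sweep): `2n` for the innermost block
(the matrix), `3` otherwise (a selected quantifier step on a fully linearized polynomial).
[cite: TrevisanVadhan2007, Lemma 4.1 (iii)] -/
def blockBound (n b : ℕ) : ℕ := if b + 1 = n then 2 * n else 3

variable [Nontrivial R]

/-- **Degrees at the end of a block.** [cite: TrevisanVadhan2007, Lemma 4.1 (iii)] [cite: AroraBarakCC2009, §8.3.3] -/
theorem degreeOf_fam_blockEnd_le (b : Fin n) (w : Fin (N n)) :
    degreeOf w (fam R n ((b.val + 1) * (N n + 1))) ≤ blockBound n b.val := by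
  rw [blockBound]
  split_ifs with hb
  · -- the innermost block reads the matrix
    rw [fam_of_length_le (by rw [length_uops, hb]), ]
    exact degreeOf_matrixPoly_le w
  · -- otherwise: the selected quantifier step of block `b + 1` on its sweep
    have hb1 : b.val + 1 < n := lt_of_le_of_ne b.isLt (fun h => hb h)
    set b' : Fin n := ⟨b.val + 1, hb1⟩ with hb'
    have e : (b.val + 1) * (N n + 1) = b'.val * (N n + 1) := rfl
    rw [e, fam_succ (blockStart_lt n b'), uops_getElem_zero n b', applyU, fam_blockStart_succ b']
    set p' := fam R n ((b'.val + 1) * (N n + 1))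
    have hs : ∀ w', degreeOf w' (((List.finRange (N n)).map UOp.lin).foldr applyU p') ≤ 1 := fun w' =>
      (degreeOf_foldr_lin_le _ p' (d := max 3 (2 * n)) (fun v => degreeOf_fam_le _ v) w').2 (List.mem_finRange w')
    refine (degreeOf_opQ_le w _ _ _).trans ?_
    have := hs w
    split_ifs <;> omega

/-- **The stage degree of the fine schedule**: the bound on the degree of `f_{n,i+1}` in the axis
variable of stage `i` — `1` at a quantifier stage, `max 1 (blockBound)` at a linearization stage.
[cite: TrevisanVadhan2007, Lemma 4.1 (iii)] [cite: AroraBarakCC2009, §8.3.3] -/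
def stageDeg (n i : ℕ) : ℕ :=
  if i % (N n + 1) = 0 then 1 else max 1 (blockBound n (i / (N n + 1)))

omit [Nontrivial R] in
/-- Division with remainder at a block index. [folklore] -/
theorem block_divMod (b t : ℕ) (ht : t < N n + 1) :
    (b * (N n + 1) + t) % (N n + 1) = t ∧ (b * (N n + 1) + t) / (N n + 1) = b := by
  constructor
  · rw [Nat.mul_comm, Nat.mul_add_mod, Nat.mod_eq_of_lt ht]
  · rw [Nat.mul_comm, Nat.mul_add_div (Nat.succ_pos _), Nat.div_eq_of_lt ht, Nat.add_zero]

/-- **The degree of `f_{n,i+1}` in the axis variable of stage `i` is at most `stageDeg n i`.**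
[cite: TrevisanVadhan2007, Lemma 4.1 (iii)] [cite: AroraBarakCC2009, §8.3.3 ("`d` an upper bound … on the degree of `U` with respect to `xᵢ`")] -/
theorem degreeOf_opVar_fam_succ_le {i : ℕ} (hi : i < mlen n) :
    degreeOf (opVar ((uops n)[i]'(by rwa [mlen] at hi))) (fam R n (i + 1)) ≤ stageDeg n i := by
  obtain ⟨b, t, ht, rfl⟩ := exists_block_of_lt_mlen hi
  obtain ⟨hmod, hdiv⟩ := block_divMod (n := n) b.val t ht
  rw [stageDeg, hmod, hdiv]
  rcases t with _ | v
  · -- a quantifier stage: the axis `x_b` has just been linearized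
    rw [if_pos rfl]
    have hget : (uops n)[b.val * (N n + 1) + 0]'(by rwa [mlen] at hi) = UOp.quant b := by
      simp only [Nat.add_zero]; exact uops_getElem_zero n b
    rw [hget, opVar, Nat.add_zero, fam_blockStart_succ b]
    exact (degreeOf_foldr_lin_le _ _ (d := blockBound n b.val) (degreeOf_fam_blockEnd_le b) _).2
      (List.mem_finRange _)
  · -- linearization `v` of block `b`: the variables `v+1, …` are linearized over the block end
    rw [if_neg (Nat.succ_ne_zero v)]
    have hv : v < N n := by omega
    set v' : Fin (N n) := ⟨v, hv⟩
    have hget : (uops n)[b.val * (N n + 1) + (v + 1)]'(by rwa [mlen] at hi) = UOp.lin v' :=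
      uops_getElem_succ n b v'
    rw [hget, opVar, show b.val * (N n + 1) + (v + 1) + 1 = b.val * (N n + 1) + (v + 2) by ring,
      fam_block b (by omega : v + 2 ≤ N n + 1)]
    have hdrop : (ublockOps n b).drop (v + 2) = (((List.finRange (N n)).drop (v + 1)).map UOp.lin) := by
      rw [ublockOps, show v + 2 = (v + 1) + 1 by rfl, List.drop_succ_cons, List.map_drop]
    rw [hdrop]
    exact (degreeOf_foldr_lin_le _ _ (d := blockBound n b.val) (degreeOf_fam_blockEnd_le b) v').1

omit [Nontrivial R] in
/-- Every stage degree is at most `max 3 (2n)`. [folklore] -/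
theorem stageDeg_le (n i : ℕ) : stageDeg n i ≤ max 3 (2 * n) := by
  rw [stageDeg, blockBound]
  split_ifs <;> omega

omit [Nontrivial R] in
/-- At a positive size, `2 · stageDeg n i ≤ Dn n + 2`. [folklore] -/
theorem two_mul_stageDeg_le {n : ℕ} (hn : 0 < n) (i : ℕ) : 2 * stageDeg n i ≤ Dn n + 2 := by
  have h1 := stageDeg_le n i
  have hN : 2 ≤ N n := by rw [N_eq]; nlinarith
  have h2 : 2 * max 3 (2 * n) ≤ Dn n := by
    rw [Dn]; exact Nat.mul_le_mul_right _ hN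
  omega

omit [Nontrivial R] in
/-- Summing over `range (m · c)` block by block. [folklore] -/
theorem sum_range_mul_eq (g : ℕ → ℕ) (c : ℕ) : ∀ m : ℕ,
    ∑ i ∈ range (m * c), g i = ∑ b ∈ range m, ∑ t ∈ range c, g (b * c + t)
  | 0 => by simp
  | m + 1 => by
    rw [sum_range_succ, ← sum_range_mul_eq g c m, Nat.succ_mul,
      ← sum_range_add_sum_Ico g (Nat.le_add_right (m * c) c), sum_Ico_eq_sum_range, Nat.add_sub_cancel_left]

omit [Nontrivial R] in
/-- The stage degrees of one block sum to `1 + N n · max 1 (blockBound n b)`. [folklore] -/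
theorem sum_stageDeg_block (n b : ℕ) :
    ∑ t ∈ range (N n + 1), stageDeg n (b * (N n + 1) + t) = 1 + N n * max 1 (blockBound n b) := by
  rw [sum_range_succ', Nat.add_comm]
  congr 1
  · obtain ⟨hmod, hdiv⟩ := block_divMod (n := n) b 0 (Nat.succ_pos _)
    rw [stageDeg, hmod, if_pos rfl]
  · have : ∀ t ∈ range (N n), stageDeg n (b * (N n + 1) + (t + 1)) = max 1 (blockBound n b) := by
      intro t ht
      obtain ⟨hmod, hdiv⟩ := block_divMod (n := n) b (t + 1) (by rw [mem_range] at ht; omega)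
      rw [stageDeg, hmod, hdiv, if_neg (Nat.succ_ne_zero t)]
    rw [sum_congr rfl this, sum_const, card_range, smul_eq_mul]

omit [Nontrivial R] in
/-- **The stage degrees are small on average**: `2 Σ_{i < mlen n} stageDeg n i ≤ 5 (Dn n + 2)`.
(`Σ = n + N n · (3 (n-1) + 2n)` for `n ≥ 2`, against `Dn n = 2 n · N n`.) [cite: AroraBarakCC2009, §8.3.3 (degree bookkeeping)] -/
theorem two_mul_sum_stageDeg_le (n : ℕ) : 2 * ∑ i ∈ range (mlen n), stageDeg n i ≤ 5 * (Dn n + 2) := by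
  rw [mlen, length_uops, sum_range_mul_eq, sum_congr rfl fun b _ => sum_stageDeg_block n b]
  rcases Nat.eq_zero_or_pos n with rfl | hn
  · simp
  · obtain ⟨m, rfl⟩ : ∃ m, n = m + 1 := ⟨n - 1, by omega⟩
    rw [sum_range_succ]
    have hinner : ∀ b ∈ range m, (1 + N (m + 1) * max 1 (blockBound (m + 1) b)) = 1 + N (m + 1) * 3 := by
      intro b hb
      rw [mem_range] at hb
      rw [blockBound, if_neg (by omega)]
      norm_num
    rw [sum_congr rfl hinner, sum_const, card_range, smul_eq_mul, blockBound, if_pos rfl]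
    have hN : N (m + 1) = 2 * ((m + 1) * (m + 1)) + 2 * (m + 1) := N_eq _
    rw [Dn]
    rcases Nat.eq_zero_or_pos m with rfl | hm
    · norm_num [hN]
    · have hmax1 : max 1 (2 * (m + 1)) = 2 * (m + 1) := max_eq_right (by omega)
      have hmax3 : max 3 (2 * (m + 1)) = 2 * (m + 1) := max_eq_right (by omega)
      rw [hmax1, hmax3]
      nlinarith [hN]

end Schedule

/-! ### The chain of Trevisan–Vadhan's family -/

/-- `mlen n > 0` for `n > 0`. [folklore] -/
theorem mlen_pos {n : ℕ} (hn : 0 < n) : 0 < mlen n := by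
  rw [mlen, length_uops]; exact Nat.mul_pos hn (Nat.succ_pos _)

/-- The operator of stage `i` (the index reduced modulo `mlen n`, so that the function is total; for
`i < mlen n` it is `(uops n)[i]`). [folklore] -/
def opAt (n : ℕ) (hn : 0 < n) (i : ℕ) : UOp n := (uops n)[i % mlen n]'(by rw [← mlen]; exact Nat.mod_lt _ (mlen_pos hn))

/-- For `i < mlen n` the stage operator is `(uops n)[i]`. [folklore] -/
theorem opAt_eq {n : ℕ} (hn : 0 < n) {i : ℕ} (hi : i < mlen n) :
    opAt n hn i = (uops n)[i]'(by rwa [mlen] at hi) := by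
  simp only [opAt, Nat.mod_eq_of_lt hi]

/-- **Trevisan–Vadhan's family as a polynomial chain with axis-line downward structure**: level `i`
is `x ↦ f_{n,i}(x)`, the axis of stage `i` is the variable its operator acts on, the rule is the
operator's two-point evaluation `opValue`. [cite: TrevisanVadhan2007, Lemma 4.1 (i)] -/
def tvChain (n : ℕ) (hn : 0 < n) : ChainCheck.Chain (K n) (Fin (N n)) where
  P i x := eval x (fam (K n) n i)
  a i := opVar (opAt n hn i)
  c i x V0 V1 := opValue (opAt n hn i) x V0 V1

/-- **The downward rule holds along the whole schedule** (`f_{n,i} = op_i f_{n,i+1}` evaluated at two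
axis points). [cite: TrevisanVadhan2007, Lemma 4.1 (i)] -/
theorem tvChain_rule {n : ℕ} (hn : 0 < n) : (tvChain n hn).Rule (mlen n) := by
  intro i hi x
  show eval x (fam (K n) n i) = opValue (opAt n hn i) x (eval (Function.update x (opVar (opAt n hn i)) 0) (fam (K n) n (i + 1)))
    (eval (Function.update x (opVar (opAt n hn i)) 1) (fam (K n) n (i + 1)))
  rw [opAt_eq hn hi, fam_succ (by rwa [mlen] at hi), eval_applyU_eq_opValue]

/-- **The stage-by-stage axis degrees of the chain.** [cite: TrevisanVadhan2007, Lemma 4.1 (iii)] -/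
theorem tvChain_axisDegreeV {n : ℕ} (hn : 0 < n) : (tvChain n hn).AxisDegreeV (stageDeg n) (mlen n) :=
  (tvChain n hn).axisDegreeV_of_degreeOf (stageDeg n) (fun i => fam (K n) n i) (fun _ _ _ => rfl)
    fun i hi => by
      show degreeOf (opVar (opAt n hn i)) (fam (K n) n (i + 1)) ≤ stageDeg n i
      rw [opAt_eq hn hi]; exact degreeOf_opVar_fam_succ_le hi

/-! ### The interpolation nodes: field elements by bit pattern -/

/-- **Node `l`**: the field element whose coordinate vector (in the power basis) is the binary
expansion of `l`. [folklore] -/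
def node (n : ℕ) (l : ℕ) : K n := decF (Mof n) fun t => l.testBit t.val

/-- Distinct small numbers give distinct nodes: `node n` is injective on `l < 2^{blk n}`. [folklore] -/
theorem node_injOn {n l₁ l₂ : ℕ} (h1 : l₁ < 2 ^ blk n) (h2 : l₂ < 2 ^ blk n) (h : node n l₁ = node n l₂) : l₁ = l₂ := by
  have hw : (fun t : Fin (blk n) => l₁.testBit t.val) = fun t => l₂.testBit t.val := by
    have := congrArg (encF (Mof n)) h
    rwa [node, node, encF_decF, encF_decF] at this
  refine Nat.eq_of_testBit_eq fun t => ?_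
  by_cases ht : t < blk n
  · exact congrFun hw ⟨t, ht⟩
  · push Not at ht
    rw [Nat.testBit_lt_two_pow (h1.trans_le (Nat.pow_le_pow_right (by norm_num) ht)),
      Nat.testBit_lt_two_pow (h2.trans_le (Nat.pow_le_pow_right (by norm_num) ht))]

/-- **The node condition of the chain**: at every stage the `stageDeg n i + 1` nodes are distinct
(`stageDeg n i < Dn n + 2 ≤ 2^{blk n} = |K n|`). [folklore] -/
theorem nodesInj_node {n : ℕ} (hn : 0 < n) : ChainCheck.Chain.NodesInj (node n) (stageDeg n) (mlen n) := by
  intro i _ l₁ l₂ h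
  have hbound : stageDeg n i + 1 ≤ 2 ^ blk n := by
    have := two_mul_stageDeg_le hn i
    have := two_pow_blk_ge n
    omega
  exact Fin.ext (node_injOn (l₁.isLt.trans_le hbound) (l₂.isLt.trans_le hbound) h)

/-! ### Completeness and soundness of the repeated run -/

/-- `|K n| = 2^{blk n} ≥ Dn n + 2`. [folklore] -/
theorem Dn_add_two_le_card (n : ℕ) : Dn n + 2 ≤ Fintype.card (K n) := by
  rw [card_K]; exact two_pow_blk_ge n

/-- **Perfect completeness of a run of the TV downward checker**: against a level oracle truthful on the
levels `i+1, …, mlen n`, a run from level `i` at any point and any challenges returns exactly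
`good (f_{n,i}(x))`. [cite: LundEtAl1992, §3 (completeness)] [cite: Santhanam2009, Lemma 12 (2)] -/
theorem tv_checksV_of_honest {n : ℕ} (hn : 0 < n) (O : ℕ → (Fin (N n) → K n) → K n) (good : K n → Bool)
    {i j : ℕ} (hij : i + j ≤ mlen n)
    (hO : ∀ i', i < i' → i' ≤ mlen n → ∀ y, O i' y = eval y (fam (K n) n i')) (x : Fin (N n) → K n)
    (rs : Fin j → K n) :
    (tvChain n hn).checksV (node n) (stageDeg n) O good j i x rs = good (eval x (fam (K n) n i)) :=
  (tvChain n hn).checksV_of_honest (node n) (stageDeg n) (nodesInj_node hn) (tvChain_axisDegreeV hn)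
    (tvChain_rule hn) O good hij hO x rs

/-- The partial sums of stage degrees are within the budget `5 |K n| / 2`. [folklore] -/
theorem two_mul_sum_stageDeg_shift_le {n i j : ℕ} (hij : i + j ≤ mlen n) :
    2 * ∑ s ∈ range j, stageDeg n (i + s) ≤ 5 * Fintype.card (K n) := by
  have h1 : ∑ s ∈ range j, stageDeg n (i + s) ≤ ∑ i' ∈ range (mlen n), stageDeg n i' := by
    have e : ∑ s ∈ range j, stageDeg n (i + s) = ∑ k ∈ Ico i (i + j), stageDeg n k := by
      rw [sum_Ico_eq_sum_range, Nat.add_sub_cancel_left]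
    rw [e]
    exact sum_le_sum_of_subset fun s hs => by rw [mem_Ico] at hs; rw [mem_range]; omega
  have h2 := two_mul_sum_stageDeg_le n
  have h3 := Dn_add_two_le_card n
  omega

/-- **`1/3`-soundness of sixty-four runs of the TV downward checker** at Trevisan–Vadhan's own field:
if the true value `f_{n,i}(x)` fails `good`, then against EVERY level oracle at most a third of the
`64`-tuples of challenge vectors make all runs accept. [cite: Santhanam2009, Lemma 12 (3)] [cite: AroraBarakCC2009, Thm. 8.21 (Claim)] [cite: TrevisanVadhan2007, Thm. 5.4] -/
theorem tv_prob_forall_checksV_le {n : ℕ} (hn : 0 < n) (O : ℕ → (Fin (N n) → K n) → K n) (good : K n → Bool)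
    {i j : ℕ} (hij : i + j ≤ mlen n) (x : Fin (N n) → K n) (hbad : good (eval x (fam (K n) n i)) = false) :
    (#{R : Fin 64 → (Fin j → K n) |
        ∀ t, (tvChain n hn).checksV (node n) (stageDeg n) O good j i x (R t) = true} : ℝ) /
        ((Fintype.card (K n) : ℝ) ^ j) ^ 64 ≤ 1 / 3 :=
  (tvChain n hn).prob_forall_checksV_le (node n) (stageDeg n) (nodesInj_node hn) (tvChain_axisDegreeV hn)
    (tvChain_rule hn) O good hij (two_mul_sum_stageDeg_shift_le hij)
    (fun s _ => (two_mul_stageDeg_le hn (i + s)).trans (Dn_add_two_le_card n)) x hbad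

/-! ### The level oracle read off a word oracle -/

/-- **The level-`i'` point oracle** presented by a word oracle `A`: the field value reassembled from the
`blk n` answers of `A` at the words of the point of length `h n i'`. [cite: TrevisanVadhan2007, Thm. 4.3 (proof)] -/
def pointOracle (A : List Bool → Bool) (n i' : ℕ) (y : Fin (N n) → K n) : K n :=
  decF (Mof n) fun l => A (wordOf n y l (h n i'))

/-- **A word oracle right at length `h n i'` is truthful on level `i'`** (for the checker started at a
word of length `≥ h n i`, the deeper levels `i' > i` are the SHORTER lengths `h n i' < h n i`).
[cite: TrevisanVadhan2007, Thm. 4.3 (proof, (b))] -/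
theorem pointOracle_eq_eval (A : List Bool → Bool) {n i' : ℕ} (hi' : i' ≤ mlen n)
    (hA : ∀ z : List Bool, z.length = h n i' → A z = FB z) (y : Fin (N n) → K n) :
    pointOracle A n i' y = eval y (fam (K n) n i') := by
  rw [pointOracle, ← decF_Fni_wordOf n i' y (h n i')]
  congr 1
  funext l
  have hlen : (wordOf n y l (h n i')).length = h n i' := length_wordOf n y l (by rw [h]; omega)
  rw [hA _ hlen, FB_eq_Fni hi' hlen]

/-- The deeper canonical lengths are shorter: `h n i' < h n i` for `i < i' ≤ mlen n`. [folklore] -/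
theorem h_lt_h {n i i' : ℕ} (hii' : i < i') (hi' : i' ≤ mlen n) : h n i' < h n i := by
  rw [h, h]; omega

end QBFUniv

end Literature.Computability.Complexity

end
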